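import Literature.AlgebraicGeometry.Milne1999.CMTypeSimpleIsogenyFactors
import Literature.RingTheory.CentralSimple.PositiveInvolutionStableSubalgebra
import Literature.AlgebraicGeometry.Motives.AbelianVarietyEndAlgebraInstances
import HarnessLib

/-!
# `End⁰` along an isogeny: the `ℚ`-algebra ISOMORPHISM, matching of endomorphisms, and transport of positive anti-involutions

Topic: `Literature/AlgebraicGeometry/Motives`.  PROOF FILE (theorems only; no definition, no named fact).  For abelian
varieties `X`, `Y` over a field `K` of characteristic zero and an isogeny `u : X → Y`:

* `endAlgebraTransport_endAlgebraTransport` — the ★ transports `End⁰(X) → End⁰(Y)`, `x ↦ N⁻¹·(u x v)` and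
  `End⁰(Y) → End⁰(X)`, `y ↦ N⁻¹·(v y u)` along a quasi-inverse pair (`v u = [N]`, `u v = [N]`,
  ★ `AbelianVariety.endAlgebraTransport`, Mumford §19 Remark p. 172) are mutually inverse: `N⁻²·(v (u x v) u) = x`.
* `endAlgebraTransport_of_eq_of_comp_eq` — if `ψ ≫ u = u ≫ φ` (`ψ ∈ End X`, `φ ∈ End Y`, i.e. `φ = u ψ u⁻¹` in `Hom⁰`), the
  transport sends `[ψ]` to `[φ]`: `N⁻¹·(u ψ v) = N⁻¹·(φ u v) = φ`.
* `IsIsogeny.exists_endAlgebra_algEquiv` — **an isogeny induces a `ℚ`-algebra isomorphism `e : End⁰(X) ≃ₐ[ℚ] End⁰(Y)`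
  with `e [ψ] = [φ]` whenever `ψ ≫ u = u ≫ φ`** (and `e.symm [φ] = [ψ]`).
* `IsIsogeny.exists_isPositiveAntiInvolution_of_comp_eq` — **transport of a positive anti-involution to a stable
  subalgebra across an isogeny**: if `σ` is a positive anti-involution of `End⁰(Y)` (e.g. a Rosati involution) and
  `ρ : B →ₐ[ℚ] End⁰(X)` is an injective `ℚ`-algebra homomorphism whose image, moved to `End⁰(Y)` by `e`, is `σ`-stable,
  then `B` carries a positive anti-involution `τ` with `σ (e (ρ b)) = e (ρ (τ b))` (★ `IsPositiveAntiInvolution.exists_of_injective`,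
  Milne CM Prop. 1.37, applied to the injective `e ∘ ρ`).

Use (cell `hodgecm-mathlib`, road (P), «gap-J»): the Jacobian of a pointed curve over a number field base-changed to `ℂ`
is only ISOGENOUS in the tree to the complex Jacobian (★ `Jacobian.exists_isIsogeny_baseChange_complex`, compatible with the
difference maps); the Rosati positivity produced on the complex side is moved to the Hecke subalgebra on the arithmetic side
through `End⁰`, where isogenies are invertible.  Ours (corollary layer over ★ `endAlgebraTransport`).

Mathlib searched: `AlgEquiv.ofAlgHom`, `AlgHom.comp_apply`, `Algebra.smul_def`, `map_natCast`, `mul_inv_cancel₀` (used);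
no `End ⊗ ℚ` of abelian varieties in Mathlib.

## References
* [MumfordAV1970] D. Mumford, *Abelian Varieties* (1970), §19 Theorem 3 and the Remark on p. 172 (`Hom⁰`, isogenies are
  invertible in `End⁰`).
* [Milne1986AbelianVarieties] J. S. Milne, *Abelian Varieties* (Cornell–Silverman 1986), §12 p. 122.
* [MilneCM2006] J. S. Milne, *Complex Multiplication* (2006), Ch. I §1 Prop. 1.37 (p. 20) (positive involutions on stable
  subalgebras).
-/

set_option autoImplicit false

noncomputable section

open CategoryTheory
open Literature.RingTheory.CentralSimple (IsPositiveAntiInvolution IsAntiInvolution)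

namespace Literature.AlgebraicGeometry.Motives.AbelianVariety

universe u

variable {K : Type u} [Field K] {X Y : AbelianVariety K}

/-! ## §1 The two transports are mutually inverse; matching of endomorphisms -/

section Transport

variable {u : X ⟶ Y} {v : Y ⟶ X} {N : ℕ}

/-- **Round trip**: `N⁻¹·(v (N⁻¹·(u x v)) u) = N⁻²·(v u) x (v u) = x` on `End⁰(X)` (★ `endConj_endConj`:
`v (u F v) u = N² F`; elements of `End⁰` are `M⁻¹ ⊗ F`, ★ `endAlgebra.exists_eq_algebraMap_mul_of`).
[cite: MumfordAV1970, §19 Remark p. 172] -/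
theorem endAlgebraTransport_endAlgebraTransport (hN : 0 < N) (huv : u ≫ v = N • 𝟙 X) (hvu : v ≫ u = N • 𝟙 Y)
    (x : X.endAlgebra) :
    endAlgebraTransport v u N hN hvu huv (endAlgebraTransport u v N hN huv hvu x) = x := by
  have hN' : (N : ℚ) ≠ 0 := Nat.cast_ne_zero.2 hN.ne'
  obtain ⟨M, F, -, rfl⟩ := endAlgebra.exists_eq_algebraMap_mul_of x
  rw [endAlgebraTransport_algebraMap_mul_of, endAlgebraTransport_algebraMap_mul_of, endConj_endConj huv,
    map_nsmul, nsmul_eq_mul, ← map_natCast (algebraMap ℚ X.endAlgebra), ← mul_assoc, ← map_mul]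
  congr 2
  push_cast
  field_simp

/-- **Matching of endomorphisms under the transport**: if `ψ ≫ u = u ≫ φ` for `ψ ∈ End X`, `φ ∈ End Y` (so `φ` is
`u ψ u⁻¹` in `Hom⁰`), then `N⁻¹·(u ψ v) = N⁻¹·(v ≫ ψ ≫ u) = N⁻¹·(v ≫ u ≫ φ) = N⁻¹·(N φ) = φ`.
[cite: MumfordAV1970, §19 Remark p. 172] -/
theorem endAlgebraTransport_of_eq_of_comp_eq (hN : 0 < N) (huv : u ≫ v = N • 𝟙 X) (hvu : v ≫ u = N • 𝟙 Y)
    (ψ : End X) (φ : End Y) (h : End.asHom ψ ≫ u = u ≫ End.asHom φ) :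
    endAlgebraTransport u v N hN huv hvu (endAlgebra.of X ψ) = endAlgebra.of Y φ := by
  have hN' : (N : ℚ) ≠ 0 := Nat.cast_ne_zero.2 hN.ne'
  have hconj : endConj u v ψ = N • φ := by
    rw [endConj_apply, h, reassoc_of% hvu, Preadditive.nsmul_comp, Category.id_comp]
    rfl
  rw [endAlgebraTransport_of, hconj, map_nsmul, nsmul_eq_mul, ← map_natCast (algebraMap ℚ Y.endAlgebra),
    ← mul_assoc, ← map_mul, inv_mul_cancel₀ hN', map_one, one_mul]

end Transport

/-! ## §2 The `ℚ`-algebra isomorphism `End⁰(X) ≃ₐ[ℚ] End⁰(Y)` of an isogeny -/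

/-- **An isogeny `u : X → Y` induces a `ℚ`-algebra isomorphism `e : End⁰(X) ≃ₐ[ℚ] End⁰(Y)` matching `ψ` with `φ`
whenever `ψ ≫ u = u ≫ φ`** (characteristic zero).  With a quasi-inverse `v`, `u v = v u = [N]`
(★ `IsIsogeny.exists_nsmul_inverse_holds`), `e := (x ↦ N⁻¹·u x v)` with inverse `y ↦ N⁻¹·v y u` (★ `endAlgebraTransport`
both ways, `endAlgebraTransport_endAlgebraTransport`); the matching is `endAlgebraTransport_of_eq_of_comp_eq`, and for
`e.symm` by applying `e.symm` to it. [cite: MumfordAV1970, §19 Thm. 3 and Remark p. 172] [cite: Milne1986AbelianVarieties, §12 p. 122 (PDF p. 189)] -/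
theorem IsIsogeny.exists_endAlgebra_algEquiv [CharZero K] {u : X ⟶ Y} (hu : IsIsogeny u) :
    ∃ e : X.endAlgebra ≃ₐ[ℚ] Y.endAlgebra,
      (∀ (ψ : End X) (φ : End Y), End.asHom ψ ≫ u = u ≫ End.asHom φ →
        e (endAlgebra.of X ψ) = endAlgebra.of Y φ) ∧
      (∀ (ψ : End X) (φ : End Y), End.asHom ψ ≫ u = u ≫ End.asHom φ →
        e.symm (endAlgebra.of Y φ) = endAlgebra.of X ψ) := by
  obtain ⟨v, N, hN, huv, hvu⟩ := IsIsogeny.exists_nsmul_inverse_holds hu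
  let e : X.endAlgebra ≃ₐ[ℚ] Y.endAlgebra :=
    AlgEquiv.ofAlgHom (endAlgebraTransport u v N hN huv hvu) (endAlgebraTransport v u N hN hvu huv)
      (by
        ext y
        exact endAlgebraTransport_endAlgebraTransport hN hvu huv y)
      (by
        ext x
        exact endAlgebraTransport_endAlgebraTransport hN huv hvu x)
  have he : ∀ (ψ : End X) (φ : End Y), End.asHom ψ ≫ u = u ≫ End.asHom φ →
      e (endAlgebra.of X ψ) = endAlgebra.of Y φ :=
    fun ψ φ h => endAlgebraTransport_of_eq_of_comp_eq hN huv hvu ψ φ h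
  refine ⟨e, he, fun ψ φ h => ?_⟩
  rw [← he ψ φ h, AlgEquiv.symm_apply_apply]

/-! ## §3 Transport of a positive anti-involution across an isogeny to a stable subalgebra -/

/-- **Positive anti-involutions cross isogenies (stable-subalgebra form).**  Let `u : X → Y` be an isogeny (char. 0),
`σ` a positive anti-involution of the `ℚ`-algebra `End⁰(Y)` (e.g. the Rosati involution of a polarisation of `Y`), and
`ρ : B →ₐ[ℚ] End⁰(X)` an injective `ℚ`-algebra homomorphism (e.g. the inclusion of a Hecke subalgebra) such that, for the
isomorphism `e : End⁰(X) ≃ₐ[ℚ] End⁰(Y)` of `IsIsogeny.exists_endAlgebra_algEquiv`, the image `e(ρ(B))` is `σ`-stable.  Then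
`B` carries a positive anti-involution `τ` with `σ (e (ρ b)) = e (ρ (τ b))` (Milne CM Prop. 1.37 = ★
`IsPositiveAntiInvolution.exists_of_injective` for the injective `e ∘ ρ`).  Stated with `e` universally quantified over
the matching property, so that a consumer may use ANY matching isomorphism. [cite: MilneCM2006, Ch. I §1 Prop. 1.37 (p. 20)] [cite: MumfordAV1970, §19 Remark p. 172] -/
theorem IsPositiveAntiInvolution.exists_of_injective_of_algEquiv {B : Type*} [Ring B] [Algebra ℚ B]
    (e : X.endAlgebra ≃ₐ[ℚ] Y.endAlgebra) {σ : Y.endAlgebra →ₗ[ℚ] Y.endAlgebra}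
    (hσ : IsPositiveAntiInvolution Y.endAlgebra σ) (ρ : B →ₐ[ℚ] X.endAlgebra) (hρ : Function.Injective ρ)
    (hst : ∀ b, ∃ c, σ (e (ρ b)) = e (ρ c)) :
    ∃ τ : B →ₗ[ℚ] B, IsPositiveAntiInvolution B τ ∧ ∀ b, σ (e (ρ b)) = e (ρ (τ b)) := by
  have hinj : Function.Injective ((e : X.endAlgebra →ₐ[ℚ] Y.endAlgebra).comp ρ) :=
    e.injective.comp hρ
  obtain ⟨τ, hτ, hτe⟩ := hσ.exists_of_injective ((e : X.endAlgebra →ₐ[ℚ] Y.endAlgebra).comp ρ) hinj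
    (fun b => by
      obtain ⟨c, hc⟩ := hst b
      exact ⟨c, by simpa using hc⟩)
  exact ⟨τ, hτ, fun b => by simpa using hτe b⟩

end Literature.AlgebraicGeometry.Motives.AbelianVariety

end
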